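import Summits.QuantumFields.YangMills.Theorems.FluctuationComparisonRegPrIntLS1aCellMapChartReadDiagonal
import HarnessLib

/-!
# `FluctuationComparisonRegPrIntLS1aCellMapChartReadSubmersion` — FILE C OF THE CHART-READ CELL MAP: `range Dψ(0) = ⊤` AND `IsCompl (ker Dψ(0)) (ker π)`,
# `π` = RESTRICTION TO THE NON-PRIVATE BONDS (the three binders of ✓`…S1aSubmersionDensityFibreAE.exists_continuousOn_density_map_of_submersion_fibreAE`)

Cell `ym3-torus` (HUMAN RULING D-0037: rung R3 = continuum SU(2) Yang–Mills on T³ — NOT d = 4, NOT infinite volume, NOT a mass gap, NOT Clay), WIDTH COPY «width 17»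
of ym3-torus-p1, seat `ym3-torus-px17` gen 21; `--kind proof --supports stmt-QuantumFields-20520 --as helper` (count-neutral).  THEOREMS ONLY (no `def`, no `sorry`,
no `instance`, no `notation`, default heartbeats).  FILE (F5a) of the seat's 12:58Z INTENT (S1aᴴ `RunClassMembershipH` conjunct (c) at the ANCHOR heights, local-face road
on the FULL guard): the calculus half of the face; (F5b) feeds it to ✓p823765 `…S1aSubmersionDensityFibreAE` (prescribed fibre coordinate = the non-private bonds).

WHY ∕ HOW (§3).  Pure linear algebra over files A–B: a vector supported on the private bonds `β(c)` is the sum of its one-bond pieces; the off-diagonal blocks of `Dψ(0)` vanish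
(A ✓`fderiv_chartRead_single_apply_of_ne`) and the diagonal blocks are injective endomorphisms of the finite-dimensional `𝔰𝔲(2)` (B ✓`eq_zero_of_fderiv_chartRead_single_apply_self`),
hence onto (`LinearMap.surjective_of_injective`); so `Dψ(0)` maps the private-supported vectors (= `ker π`, `π A := (A b)_{b non-private}`) isomorphically onto the target:
`range Dψ(0) = ⊤`, `ker Dψ(0) ⊓ ker π = ⊥`, `ker Dψ(0) ⊔ ker π = ⊤`.

CONTENT (namespace `Summit.QuantumFields.YangMills.Theorems.FluctuationComparisonRegPrIntLS1aCellMapChartRead`, continued).  `eq_sum_single_of_private`, `sum_single_centralBond_apply`, ★`fderiv_chartRead_apply_of_private`,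
★★`eq_zero_of_private_of_fderiv_chartRead_eq_zero`, ★★`exists_private_fderiv_chartRead_eq`, ★★★`range_fderiv_chartRead_cellMap_eq_top`, `range_restrictNonPrivate_eq_top`,
`mem_ker_restrictNonPrivate_iff`, ★★★`isCompl_ker_fderiv_chartRead_cellMap_ker_restrictNonPrivate`.

HONEST FRAMING.  Chart calculus over pub-ymgap's N09∕N07 files, lit `T4EMLTangentInjective`, `Node00.AveragingSmooth`, `HaarExponentialChart*`; nothing of Bałaban's analysis is
asserted or proved; S1aᴴ (c) at the anchor heights NOT closed by this file ((F4-b) px20 g22, (F5b), (F6) remain); (m), (a), S1aᴴ, the five registered stubs, crux 20520 ∕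
19936 ∕ 19200 and `YM3TorusSU2` NOT proved; rung R3 = SU(2) YM₃ on T³ — NOT d = 4, NOT infinite volume, NOT a mass gap, NOT Clay; the Yang–Mills mass gap is NOT proved.
References: [Balaban1987RG1] CMP 109 (1987) (0.4) p. 253; [Helgason2000] Ch. I §1 Thm. 1.14; [EvansGariepy1992] §3.4.
-/

set_option autoImplicit false

noncomputable section

open scoped Matrix.Norms.L2Operator Topology ENNReal Matrix
open Filter Set Function MeasureTheory

namespace Summit.QuantumFields.YangMills.Theorems.FluctuationComparisonRegPrIntLS1aCellMapChartRead

open Literature.MathematicalPhysics.QuantumFieldTheory.Balaban1983to89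
open Literature.MathematicalPhysics.QuantumFieldTheory.Balaban1983to89.HaarExponentialChart
open Literature.MathematicalPhysics.QuantumFieldTheory.Balaban1983to89.HaarExponentialChart.IsChartRep
open Literature.MathematicalPhysics.QuantumFieldTheory.Balaban1983to89.BlockAveraging (Small Idx avgFun loopHol)
open Literature.MathematicalPhysics.QuantumFieldTheory.Balaban1983to89.BlockAveragingHaarAC (centralBond IsCentral openHol pre post centralBond_injective
  loopHol_update_centralBond axialAvg_update_centralBond_of_ne axialAvg_update_centralBond)
open Literature.MathematicalPhysics.QuantumFieldTheory.Balaban1983to89.BlockAveragingEMLHaarAC (fibreFamily offHol offCard emlWeight emlWeight_nonneg sum_emlWeight_lt_one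
  loopHol_update_centralBond_self coe_fibreFamily_of_not_isCentral fibreFamily_of_isCentral)
open Literature.MathematicalPhysics.QuantumFieldTheory.Balaban1983to89.ExpMeanLog (expMeanLogSU deltaSU eml)
open Literature.MathematicalPhysics.QuantumFieldTheory.Balaban1983to89.Node00 (SU coeField avgM axialM corrM loopM contDiffAt_corrM contDiff_axialM contDiff_loopM
  coe_loopHol coe_axialAvg coe_mul_star_coe_SU star_coe_mul_coe_SU coe_inv_SU)
open Literature.MathematicalPhysics.QuantumLattice (fundamentalRep fundamentalRep_apply)
open MatrixLog (mlog analyticAt_mlog mlog_one)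
open T4EMLTangentInjective (Kmat emlD hasStrictFDerivAt_Kmat emlD_tangent_injective)
open Summit.QuantumFields.YangMills.BalabanUVNodes.N09ChartReadAveragingSmooth (contDiffAt_of_coe coe_fderiv_apply_eq hasDerivAt_along_ray coe_expChart
  coeField_piExpChart_translate piExpChart_translate_zero contDiff_coeField_piExpChart_translate piExpChart_translate_smul_single)
open Summit.QuantumFields.YangMills.Theorems.FluctuationComparisonRegPrIntLS1aCellMapExtendedAverage

variable {P : Params} {j : ℕ}
variable (E : (Idx P → SU 2) → SU 2) (s : Finset (PBond P (j + 1))) (U₀ : GaugeField P j (SU 2))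


/-! ## §3 The fibre coordinate `π` = restriction to the NON-PRIVATE bonds: `range Dψ(0) = ⊤`, `IsCompl (ker Dψ(0)) (ker π)`

Pure linear algebra over §2: a vector supported on the private bonds `β(c)` is the sum of its one-bond pieces; the off-diagonal blocks of `Dψ(0)` vanish
(`fderiv_chartRead_single_apply_of_ne`) and the diagonal blocks are injective endomorphisms of the finite-dimensional `𝔰𝔲(2)` (`eq_zero_of_fderiv_chartRead_single_apply_self`),
hence surjective; so `Dψ(0)` restricted to the private-supported vectors (= `ker π`) is a linear isomorphism onto the target. -/

section Submersion

/-- A vector vanishing on the non-private bonds is the sum of its private one-bond pieces. [cite: Balaban1985RegularSpaces, (1.10) p.77 (bookkeeping)] -/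
theorem eq_sum_single_of_private (hj : j + 1 ≤ P.m + P.K) {x : PBond P j → (specialUnitaryLogChart (Fin 2)).lie}
    (hx : ∀ b, (∀ c : PBond P (j + 1), b ≠ centralBond c) → x b = 0) :
    x = ∑ c : PBond P (j + 1), (Pi.single (centralBond c) (x (centralBond c)) : PBond P j → (specialUnitaryLogChart (Fin 2)).lie) := by
  funext b
  rw [Finset.sum_apply]
  by_cases hb : ∃ c : PBond P (j + 1), b = centralBond c
  · obtain ⟨c, rfl⟩ := hb
    rw [Finset.sum_eq_single c (fun c' _ hc' => Pi.single_eq_of_ne ((centralBond_injective hj).ne hc').symm _) (fun h => (h (Finset.mem_univ c)).elim),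
      Pi.single_eq_same]
  · push Not at hb
    rw [hx b hb, eq_comm]
    exact Finset.sum_eq_zero fun c _ => Pi.single_eq_of_ne (hb c) _

/-- The sum of private one-bond pieces evaluates to the `c`-th piece at `β(c)` and to `0` off the private bonds. [cite: Balaban1985RegularSpaces, (1.10) p.77 (bookkeeping)] -/
theorem sum_single_centralBond_apply (hj : j + 1 ≤ P.m + P.K) (X : PBond P (j + 1) → (specialUnitaryLogChart (Fin 2)).lie) :
    (∀ c, (∑ c' : PBond P (j + 1), (Pi.single (centralBond c') (X c') : PBond P j → (specialUnitaryLogChart (Fin 2)).lie)) (centralBond c) = X c) ∧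
      ∀ b, (∀ c : PBond P (j + 1), b ≠ centralBond c) →
        (∑ c' : PBond P (j + 1), (Pi.single (centralBond c') (X c') : PBond P j → (specialUnitaryLogChart (Fin 2)).lie)) b = 0 := by
  refine ⟨fun c => ?_, fun b hb => ?_⟩
  · rw [Finset.sum_apply, Finset.sum_eq_single c (fun c' _ hc' => Pi.single_eq_of_ne ((centralBond_injective hj).ne hc').symm _)
      (fun h => (h (Finset.mem_univ c)).elim), Pi.single_eq_same]
  · rw [Finset.sum_apply]; exact Finset.sum_eq_zero fun c _ => Pi.single_eq_of_ne (hb c) _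

/-- ★ **BLOCK REDUCTION**: on a private-supported vector, the `c`-component of `Dψ(0)` only sees the `β(c)`-piece (off-diagonal blocks vanish, §2).
[cite: Balaban1985RegularSpaces, (1.10) p.77 (bookkeeping)] -/
theorem fderiv_chartRead_apply_of_private (hj : j + 1 ≤ P.m + P.K)
    (hEeml : ∀ W, (∀ i, ‖((W i : SU 2) : Matrix (Fin 2) (Fin 2) ℂ) - 1‖ < 1 / 2) →
      ((E W : SU 2) : Matrix (Fin 2) (Fin 2) ℂ) = eml fun i => ((W i : SU 2) : Matrix (Fin 2) (Fin 2) ℂ))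
    (hwin : ∀ c ∈ s, ∀ i, ‖((loopHol U₀ c i : SU 2) : Matrix (Fin 2) (Fin 2) ℂ) - 1‖ < 1 / 2)
    {x : PBond P j → (specialUnitaryLogChart (Fin 2)).lie} (hx : ∀ b, (∀ c : PBond P (j + 1), b ≠ centralBond c) → x b = 0) (c : PBond P (j + 1)) :
    fderiv ℝ (fun (A : PBond P j → (specialUnitaryLogChart (Fin 2)).lie) (c : PBond P (j + 1)) =>
      (isChartRep_specialUnitaryGroup (n := Fin 2)).logChart
        ((if c ∈ s then E (loopHol (fun b => (isChartRep_specialUnitaryGroup (n := Fin 2)).expChart (A b) * U₀ b) c) else 1) *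
            AveragingRT.axialAvg (fun b => (isChartRep_specialUnitaryGroup (n := Fin 2)).expChart (A b) * U₀ b) c *
          ((if c ∈ s then E (loopHol U₀ c) else 1) * AveragingRT.axialAvg U₀ c)⁻¹)) 0 x c =
    fderiv ℝ (fun (A : PBond P j → (specialUnitaryLogChart (Fin 2)).lie) (c : PBond P (j + 1)) =>
      (isChartRep_specialUnitaryGroup (n := Fin 2)).logChart
        ((if c ∈ s then E (loopHol (fun b => (isChartRep_specialUnitaryGroup (n := Fin 2)).expChart (A b) * U₀ b) c) else 1) *
            AveragingRT.axialAvg (fun b => (isChartRep_specialUnitaryGroup (n := Fin 2)).expChart (A b) * U₀ b) c *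
          ((if c ∈ s then E (loopHol U₀ c) else 1) * AveragingRT.axialAvg U₀ c)⁻¹)) 0 (Pi.single (centralBond c) (x (centralBond c))) c := by
  conv_lhs => rw [eq_sum_single_of_private (P := P) (j := j) hj hx]
  rw [map_sum, Finset.sum_apply, Finset.sum_eq_single c (fun c' _ hc' => ?_) (fun h => (h (Finset.mem_univ c)).elim)]
  exact fderiv_chartRead_single_apply_of_ne E s U₀ hj hEeml hwin hc'.symm (x (centralBond c'))

/-- ★★ **`Dψ(0)` IS INJECTIVE ON THE PRIVATE-SUPPORTED VECTORS** (= on `ker π`). [cite: Balaban1985RegularSpaces, (1.10)–(1.12) pp.77–78 (bookkeeping)] -/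
theorem eq_zero_of_private_of_fderiv_chartRead_eq_zero (hj : j + 1 ≤ P.m + P.K)
    (hEeml : ∀ W, (∀ i, ‖((W i : SU 2) : Matrix (Fin 2) (Fin 2) ℂ) - 1‖ < 1 / 2) →
      ((E W : SU 2) : Matrix (Fin 2) (Fin 2) ℂ) = eml fun i => ((W i : SU 2) : Matrix (Fin 2) (Fin 2) ℂ))
    (hwin : ∀ c ∈ s, ∀ i, ‖((loopHol U₀ c i : SU 2) : Matrix (Fin 2) (Fin 2) ℂ) - 1‖ < 1 / 2)
    {x : PBond P j → (specialUnitaryLogChart (Fin 2)).lie} (hx : ∀ b, (∀ c : PBond P (j + 1), b ≠ centralBond c) → x b = 0)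
    (hzero : fderiv ℝ (fun (A : PBond P j → (specialUnitaryLogChart (Fin 2)).lie) (c : PBond P (j + 1)) =>
      (isChartRep_specialUnitaryGroup (n := Fin 2)).logChart
        ((if c ∈ s then E (loopHol (fun b => (isChartRep_specialUnitaryGroup (n := Fin 2)).expChart (A b) * U₀ b) c) else 1) *
            AveragingRT.axialAvg (fun b => (isChartRep_specialUnitaryGroup (n := Fin 2)).expChart (A b) * U₀ b) c *
          ((if c ∈ s then E (loopHol U₀ c) else 1) * AveragingRT.axialAvg U₀ c)⁻¹)) 0 x = 0) :
    x = 0 := by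
  have hpriv : ∀ c, x (centralBond c) = 0 := by
    intro c
    refine eq_zero_of_fderiv_chartRead_single_apply_self E s U₀ hj hEeml hwin c (x (centralBond c)) ?_
    rw [← fderiv_chartRead_apply_of_private E s U₀ hj hEeml hwin hx c, hzero]; rfl
  funext b
  by_cases hb : ∃ c : PBond P (j + 1), b = centralBond c
  · obtain ⟨c, rfl⟩ := hb; exact hpriv c
  · push Not at hb; exact hx b hb

/-- ★★ **EVERY TARGET VECTOR IS HIT BY A PRIVATE-SUPPORTED VECTOR** (diagonal blocks are injective endomorphisms of the finite-dimensional `𝔰𝔲(2)`, hence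
surjective; off-diagonal blocks vanish). [cite: Balaban1985RegularSpaces, (1.10)–(1.12) pp.77–78 (bookkeeping)] -/
theorem exists_private_fderiv_chartRead_eq (hj : j + 1 ≤ P.m + P.K)
    (hEeml : ∀ W, (∀ i, ‖((W i : SU 2) : Matrix (Fin 2) (Fin 2) ℂ) - 1‖ < 1 / 2) →
      ((E W : SU 2) : Matrix (Fin 2) (Fin 2) ℂ) = eml fun i => ((W i : SU 2) : Matrix (Fin 2) (Fin 2) ℂ))
    (hwin : ∀ c ∈ s, ∀ i, ‖((loopHol U₀ c i : SU 2) : Matrix (Fin 2) (Fin 2) ℂ) - 1‖ < 1 / 2)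
    (y : PBond P (j + 1) → (specialUnitaryLogChart (Fin 2)).lie) :
    ∃ x : PBond P j → (specialUnitaryLogChart (Fin 2)).lie, (∀ b, (∀ c : PBond P (j + 1), b ≠ centralBond c) → x b = 0) ∧
      fderiv ℝ (fun (A : PBond P j → (specialUnitaryLogChart (Fin 2)).lie) (c : PBond P (j + 1)) =>
        (isChartRep_specialUnitaryGroup (n := Fin 2)).logChart
          ((if c ∈ s then E (loopHol (fun b => (isChartRep_specialUnitaryGroup (n := Fin 2)).expChart (A b) * U₀ b) c) else 1) *
              AveragingRT.axialAvg (fun b => (isChartRep_specialUnitaryGroup (n := Fin 2)).expChart (A b) * U₀ b) c *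
            ((if c ∈ s then E (loopHol U₀ c) else 1) * AveragingRT.axialAvg U₀ c)⁻¹)) 0 x = y := by
  set L := fderiv ℝ (fun (A : PBond P j → (specialUnitaryLogChart (Fin 2)).lie) (c : PBond P (j + 1)) =>
        (isChartRep_specialUnitaryGroup (n := Fin 2)).logChart
          ((if c ∈ s then E (loopHol (fun b => (isChartRep_specialUnitaryGroup (n := Fin 2)).expChart (A b) * U₀ b) c) else 1) *
              AveragingRT.axialAvg (fun b => (isChartRep_specialUnitaryGroup (n := Fin 2)).expChart (A b) * U₀ b) c *
            ((if c ∈ s then E (loopHol U₀ c) else 1) * AveragingRT.axialAvg U₀ c)⁻¹)) 0 with hL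
  -- the diagonal blocks as linear endomorphisms of `𝔰𝔲(2)`
  have hblock : ∀ c : PBond P (j + 1), ∀ w : (specialUnitaryLogChart (Fin 2)).lie, ∃ X : (specialUnitaryLogChart (Fin 2)).lie,
      L (Pi.single (centralBond c) X) c = w := by
    intro c
    set T : (specialUnitaryLogChart (Fin 2)).lie →ₗ[ℝ] (specialUnitaryLogChart (Fin 2)).lie :=
      (LinearMap.proj c).comp ((L : (PBond P j → (specialUnitaryLogChart (Fin 2)).lie) →ₗ[ℝ]
        (PBond P (j + 1) → (specialUnitaryLogChart (Fin 2)).lie)).comp (LinearMap.single ℝ (fun _ : PBond P j => (specialUnitaryLogChart (Fin 2)).lie) (centralBond c))) with hT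
    have hTapp : ∀ X, T X = L (Pi.single (centralBond c) X) c := fun X => rfl
    have hinj : Function.Injective T := by
      intro X X' h
      have h0 : T (X - X') = 0 := by rw [map_sub, h, sub_self]
      rw [hTapp] at h0
      exact sub_eq_zero.1 (eq_zero_of_fderiv_chartRead_single_apply_self E s U₀ hj hEeml hwin c (X - X') h0)
    intro w
    obtain ⟨X, hX⟩ := LinearMap.surjective_of_injective hinj w
    exact ⟨X, by rw [← hTapp]; exact hX⟩
  choose X hX using fun c => hblock c (y c)
  refine ⟨∑ c' : PBond P (j + 1), (Pi.single (centralBond c') (X c') : PBond P j → (specialUnitaryLogChart (Fin 2)).lie),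
    (sum_single_centralBond_apply (P := P) (j := j) hj X).2, funext fun c => ?_⟩
  rw [fderiv_chartRead_apply_of_private E s U₀ hj hEeml hwin (sum_single_centralBond_apply (P := P) (j := j) hj X).2 c,
    (sum_single_centralBond_apply (P := P) (j := j) hj X).1 c]
  exact hX c

/-- ★★★ **`range Dψ(0) = ⊤`** — the chart-read cell map is a SUBMERSION at the base point. [cite: Balaban1985RegularSpaces, (1.10)–(1.12) pp.77–78 (bookkeeping)] -/
theorem range_fderiv_chartRead_cellMap_eq_top (hj : j + 1 ≤ P.m + P.K)
    (hEeml : ∀ W, (∀ i, ‖((W i : SU 2) : Matrix (Fin 2) (Fin 2) ℂ) - 1‖ < 1 / 2) →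
      ((E W : SU 2) : Matrix (Fin 2) (Fin 2) ℂ) = eml fun i => ((W i : SU 2) : Matrix (Fin 2) (Fin 2) ℂ))
    (hwin : ∀ c ∈ s, ∀ i, ‖((loopHol U₀ c i : SU 2) : Matrix (Fin 2) (Fin 2) ℂ) - 1‖ < 1 / 2) :
    (fderiv ℝ (fun (A : PBond P j → (specialUnitaryLogChart (Fin 2)).lie) (c : PBond P (j + 1)) =>
      (isChartRep_specialUnitaryGroup (n := Fin 2)).logChart
        ((if c ∈ s then E (loopHol (fun b => (isChartRep_specialUnitaryGroup (n := Fin 2)).expChart (A b) * U₀ b) c) else 1) *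
            AveragingRT.axialAvg (fun b => (isChartRep_specialUnitaryGroup (n := Fin 2)).expChart (A b) * U₀ b) c *
          ((if c ∈ s then E (loopHol U₀ c) else 1) * AveragingRT.axialAvg U₀ c)⁻¹)) 0).range = ⊤ := by
  refine LinearMap.range_eq_top.2 fun y => ?_
  obtain ⟨x, -, hx⟩ := exists_private_fderiv_chartRead_eq E s U₀ hj hEeml hwin y
  exact ⟨x, hx⟩

/-- The restriction to the non-private bonds is onto (extend by `0`). [cite: Balaban1985RegularSpaces, (1.10) p.77 (bookkeeping)] -/
theorem range_restrictNonPrivate_eq_top :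
    (ContinuousLinearMap.pi fun b : {b : PBond P j // ∀ c : PBond P (j + 1), b ≠ centralBond c} =>
      (ContinuousLinearMap.proj (R := ℝ) (φ := fun _ : PBond P j => (specialUnitaryLogChart (Fin 2)).lie) (b : PBond P j))).range = ⊤ := by
  refine LinearMap.range_eq_top.2 fun k => ⟨Function.extend Subtype.val k 0, funext fun b => ?_⟩
  exact Subtype.val_injective.extend_apply _ _ b

/-- Membership in the kernel of the restriction = vanishing on the non-private bonds. [cite: Balaban1985RegularSpaces, (1.10) p.77 (bookkeeping)] -/
theorem mem_ker_restrictNonPrivate_iff (x : PBond P j → (specialUnitaryLogChart (Fin 2)).lie) :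
    x ∈ (ContinuousLinearMap.pi fun b : {b : PBond P j // ∀ c : PBond P (j + 1), b ≠ centralBond c} =>
      (ContinuousLinearMap.proj (R := ℝ) (φ := fun _ : PBond P j => (specialUnitaryLogChart (Fin 2)).lie) (b : PBond P j))).ker ↔
      ∀ b, (∀ c : PBond P (j + 1), b ≠ centralBond c) → x b = 0 := by
  rw [LinearMap.mem_ker]
  constructor
  · intro h b hb
    exact congr_fun h ⟨b, hb⟩
  · intro h
    funext b
    exact h b.1 b.2

/-- ★★★ **`IsCompl (ker Dψ(0)) (ker π)`** — the non-private bonds are a fibre coordinate TRANSVERSE to the kernel (the private-supported vectors map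
isomorphically onto the target). [cite: Balaban1985RegularSpaces, (1.10)–(1.12) pp.77–78 (bookkeeping)] -/
theorem isCompl_ker_fderiv_chartRead_cellMap_ker_restrictNonPrivate (hj : j + 1 ≤ P.m + P.K)
    (hEeml : ∀ W, (∀ i, ‖((W i : SU 2) : Matrix (Fin 2) (Fin 2) ℂ) - 1‖ < 1 / 2) →
      ((E W : SU 2) : Matrix (Fin 2) (Fin 2) ℂ) = eml fun i => ((W i : SU 2) : Matrix (Fin 2) (Fin 2) ℂ))
    (hwin : ∀ c ∈ s, ∀ i, ‖((loopHol U₀ c i : SU 2) : Matrix (Fin 2) (Fin 2) ℂ) - 1‖ < 1 / 2) :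
    IsCompl
      (fderiv ℝ (fun (A : PBond P j → (specialUnitaryLogChart (Fin 2)).lie) (c : PBond P (j + 1)) =>
        (isChartRep_specialUnitaryGroup (n := Fin 2)).logChart
          ((if c ∈ s then E (loopHol (fun b => (isChartRep_specialUnitaryGroup (n := Fin 2)).expChart (A b) * U₀ b) c) else 1) *
              AveragingRT.axialAvg (fun b => (isChartRep_specialUnitaryGroup (n := Fin 2)).expChart (A b) * U₀ b) c *
            ((if c ∈ s then E (loopHol U₀ c) else 1) * AveragingRT.axialAvg U₀ c)⁻¹)) 0).ker
      (ContinuousLinearMap.pi fun b : {b : PBond P j // ∀ c : PBond P (j + 1), b ≠ centralBond c} =>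
        (ContinuousLinearMap.proj (R := ℝ) (φ := fun _ : PBond P j => (specialUnitaryLogChart (Fin 2)).lie) (b : PBond P j))).ker := by
  refine isCompl_iff.2 ⟨Submodule.disjoint_def.2 fun x hx hx' => ?_, codisjoint_iff_le_sup.2 fun x _ => ?_⟩
  · exact eq_zero_of_private_of_fderiv_chartRead_eq_zero E s U₀ hj hEeml hwin ((mem_ker_restrictNonPrivate_iff (P := P) (j := j) x).1 hx')
      ((LinearMap.mem_ker).1 hx)
  · obtain ⟨b', hb', hLb'⟩ := exists_private_fderiv_chartRead_eq E s U₀ hj hEeml hwin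
      (fderiv ℝ (fun (A : PBond P j → (specialUnitaryLogChart (Fin 2)).lie) (c : PBond P (j + 1)) =>
        (isChartRep_specialUnitaryGroup (n := Fin 2)).logChart
          ((if c ∈ s then E (loopHol (fun b => (isChartRep_specialUnitaryGroup (n := Fin 2)).expChart (A b) * U₀ b) c) else 1) *
              AveragingRT.axialAvg (fun b => (isChartRep_specialUnitaryGroup (n := Fin 2)).expChart (A b) * U₀ b) c *
            ((if c ∈ s then E (loopHol U₀ c) else 1) * AveragingRT.axialAvg U₀ c)⁻¹)) 0 x)
    refine Submodule.mem_sup.2 ⟨x - b', ?_, b', (mem_ker_restrictNonPrivate_iff (P := P) (j := j) b').2 hb', sub_add_cancel x b'⟩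
    simp only [LinearMap.mem_ker, map_sub, ContinuousLinearMap.coe_coe, hLb', sub_self]

end Submersion

end Summit.QuantumFields.YangMills.Theorems.FluctuationComparisonRegPrIntLS1aCellMapChartRead

end
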